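import Summits.BirchSwinnertonDyer.BirchSwinnertonDyer.Theorems.CyclotomicUntwistConjugateLFunctions
import Summits.BirchSwinnertonDyer.BirchSwinnertonDyer.Theorems.CyclotomicUntwistCoefficientField
import HarnessLib

/-!
# `𝓛^{η̄}_W = σ ∘ 𝓛^{η}_W` over `ℚ₃(ζ₃)`: the conjugate principal-series `3`-adic `L`-function of the route
# `CyclotomicUntwist` exists with the first, is its `σ`-conjugate, and has the same order of vanishing and
# leading norm at the trivial character

Cell `pub/bsd-wall` (D-0145 line `route-BirchSwinnertonDyer-CyclotomicUntwist`), width seat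
`bsd-line-cycu-p5` g5. THEOREMS ONLY (no definition, no named fact, no `sorry`); helper `--supports`
K1 = stmt-BirchSwinnertonDyer-21580 (`PSRankOneLowerHalfAtThree`). BSD is not proved by this file and no
crux of the route is proved by it; K1/K2 stay open and WHOLE.

WHAT. The `p = 3`, `K = ℚ₃(ζ₃) = CyclotomicField 3 ℚ_[3]` instance of `CyclotomicUntwistConjugateLFunctions`
(general coefficient fields, two embeddings with one norm) in the currency of the route's coefficient package
(`PSCoefficientField`, `PSLineCoefficients`: `ι : K →ₐ[ℚ₃] ℂ₃`, `σ ∈ Aut(K/ℚ₃)` with `σ ζ₃ = ζ₃²`):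

* §1 `exists_algEquiv_apply_eq_inv_of_pow_six` / `exists_algEquiv_ringHomComp_eq_inv_of_pow_six` — cycu-p1's
  conjugation `σ` (stated there for cube roots of unity / characters with `ψ³ = 1`) inverts every SIXTH root of
  unity, hence `η.ringHomComp σ = η⁻¹` for every Dirichlet character `η` (any level) with `η⁶ = 1` — both orders
  `3` and `6` of the route's untwisting character `η` mod `9`.
* §2 **`exists_conjugate_of_isPSCyclotomicLFunctionOf`** (no Carayol hypothesis): for `W/ℚ`, `η_K` primitive
  mod `9` with `η_K⁶ = 1`, `α_K ∈ K ∖ {0, 3}` and `μ` with `IsPSCyclotomicLFunctionOf W (η_K ∘ ι) (ι α_K) μ`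
  (`η_K ∘ ι := η_K.ringHomComp ι`): there is a `K`-valued `μ_K` with `μ = ι ∘ μ_K` (rationality), and
  `ι ∘ σ ∘ μ_K` satisfies `IsPSCyclotomicLFunctionOf W (η_K ∘ ι)⁻¹ (ι (σ α_K))` — the CONJUGATE untwisted
  `L`-function `𝓛^{η̄}_W` (root `ᾱ = σ α = a₃(ḡ)`) — with `‖𝓛^{η̄}(ball)‖ = ‖𝓛^{η}(ball)‖`,
  `‖c_k(𝓛^{η̄})‖ = ‖c_k(𝓛^{η})‖` for all `k`, `ord_𝟙 𝓛^{η̄} = ord_𝟙 𝓛^{η}` (`gammaOrderAtOne`) and equal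
  leading norms (`gammaLeadingCoeff`).
* §3 granted Carayol's level statement (`hlev`, as in `PSGammaUniqueness.eq_of_isPSCyclotomicLFunctionOf`):
  **`eq_conj_of_isPSCyclotomicLFunctionOf`** — ANY `𝓛^{η̄}_W` (for the root `σ α`) is `ι ∘ σ ∘ μ_K` where
  `𝓛^{η}_W = ι ∘ μ_K`, and `conjugate_invariants_of_isPSCyclotomicLFunctionOf` — the two have the invariants above
  in common; `exists_isPSCyclotomicLFunctionOf_inv_iff` — `𝓛^{η̄}_W` exists iff `𝓛^{η}_W` does.

WHY (route bookkeeping). The thesis' `σ`-symmetry ("`L^η, L^η̄` Galois-conjugate", "`h_ψ̄ = σ h_ψ`") now has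
BOTH faces in the tree: algebraic (`PSCoefficientField.PSLineHeightData.exists_conj_three`) and analytic (this
file). Consequences for K1's pins: GZ₃ / pBSD₃ / MATCH of `CyclotomicUntwistFiniteSlopeSeparated` must hold
with the same norms for `(η̄, ᾱ)` as for `(η, α)` — a refuter-grade consistency test of any proposed D4
constants `κ_an`, `κ_alg` (they must be `σ`-equivariant in norm); and on a rank-one PS row
`ord_𝟙 𝓛^{η} = 1 ⟺ ord_𝟙 𝓛^{η̄} = 1`, matching "`Reg_ψ`, `Reg_ψ̄` vanish together".

References: [cite: MazurTateTeitelbaum1986Invent, §I.10 and §I.14 (case p ∣ N)] · [cite: Bellaiche2021, Thm. 6.7.9]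
· [cite: Benois2020, §0.3] · [cite: BoschGuntzerRemmert1984, §3.2.4 Thm. 2].
-/

noncomputable section

open scoped MatrixGroups

open Filter Topology CongruenceSubgroup DirichletCharacter Literature.NumberTheory.EllipticCurves
  Literature.NumberTheory.EllipticCurves.ModularForms Literature.NumberTheory.IwasawaTheory
  Summit.BirchSwinnertonDyer.BirchSwinnertonDyer.Theorems.PSCandidateUniqueness
  Summit.BirchSwinnertonDyer.BirchSwinnertonDyer.Theorems.PSConjugateLFunctions

-- single-conjunct summit: `Summit.BirchSwinnertonDyer.BirchSwinnertonDyer.…` repeats the name by design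
set_option linter.dupNamespace false
set_option autoImplicit false

namespace Summit.BirchSwinnertonDyer.BirchSwinnertonDyer.Theorems.PSConjugateLFunctionsThree

/-! ### §0 The `K`-valued candidate exists (its four defining equations are definitions) -/

/-- For any coefficient field `K`, character `η_K` mod `p^c`, root `α_K` and cusp form `f`, the `K`-valued
untwisted candidate `(S_K, ν_K, ρ_K, 𝓛_K)` of `PSCandidateUniqueness` §2 EXISTS — the four hypothesis-equations
are explicit formulas. [cite: MazurTateTeitelbaum1986Invent, §I.10] -/
theorem exists_candidateK {p : ℕ} [Fact p.Prime] {K : Type*} [Field K] {N : ℕ} (f : CuspForm (Gamma0 N) 2)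
    {c : ℕ} (ηK : DirichletCharacter K (p ^ c)) (αK : K) :
    ∃ (SK : (j : ℕ) → ZMod (p ^ j) → K) (νK : (M : ℕ) → ZMod (p ^ M) → K)
      (ρK : (M : ℕ) → ZMod (p ^ M) → K) (𝓛K : (n : ℕ) → ZMod (p ^ n) → K),
      (∀ (j : ℕ) (y : ZMod (p ^ j)), SK j y = ∑ b : ZMod (p ^ c), ηK b *
        ((ratPlusSymbol f ((y.val : ℚ) / (p : ℚ) ^ j + (b.val : ℚ) / (p : ℚ) ^ c) : ℚ) : K)) ∧
      (∀ (M : ℕ) (x : ZMod (p ^ M)), νK M x =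
        (∑ i ∈ Finset.range M, αK⁻¹ ^ (i + 1) * ((p : K) ^ (i + 1) / (p : K) ^ M) *
            SK (i + 1) ((x.val : ℕ) : ZMod (p ^ (i + 1)))) +
          ((p : K) ^ M)⁻¹ * (1 - αK / p)⁻¹ * SK 0 0) ∧
      (∀ (M : ℕ) (y : ZMod (p ^ M)), ρK M y = ηK⁻¹ ((y.val : ℕ) : ZMod (p ^ c)) * νK M y) ∧
      (∀ (n : ℕ) (s : ZMod (p ^ n)), 𝓛K n s =
        ∑ᶠ T : rootsOfUnity (torsionOrder p) ℤ_[p],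
          ∑ y ∈ Finset.univ.filter (fun y : ZMod (p ^ (c + cyclotomicExponent p + n)) ↦
            ZMod.castHom (pow_dvd_pow p (by omega : cyclotomicExponent p + n ≤ c + cyclotomicExponent p + n))
                (ZMod (p ^ (cyclotomicExponent p + n))) y =
              PadicInt.toZModPow (cyclotomicExponent p + n) ((T : ℤ_[p]ˣ) : ℤ_[p]) *
                (cyclotomicGenerator p : ZMod (p ^ (cyclotomicExponent p + n))) ^ s.val),
            ρK (c + cyclotomicExponent p + n) y) := by
  classical
  let SK : (j : ℕ) → ZMod (p ^ j) → K := fun j y ↦ ∑ b : ZMod (p ^ c), ηK b *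
    ((ratPlusSymbol f ((y.val : ℚ) / (p : ℚ) ^ j + (b.val : ℚ) / (p : ℚ) ^ c) : ℚ) : K)
  let νK : (M : ℕ) → ZMod (p ^ M) → K := fun M x ↦
    (∑ i ∈ Finset.range M, αK⁻¹ ^ (i + 1) * ((p : K) ^ (i + 1) / (p : K) ^ M) *
        SK (i + 1) ((x.val : ℕ) : ZMod (p ^ (i + 1)))) +
      ((p : K) ^ M)⁻¹ * (1 - αK / p)⁻¹ * SK 0 0
  let ρK : (M : ℕ) → ZMod (p ^ M) → K := fun M y ↦ ηK⁻¹ ((y.val : ℕ) : ZMod (p ^ c)) * νK M y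
  exact ⟨SK, νK, ρK, _, fun _ _ ↦ rfl, fun _ _ ↦ rfl, fun _ _ ↦ rfl, fun _ _ ↦ rfl⟩

/-! ### §1 The conjugation of `ℚ₃(ζ₃)` inverts sixth roots of unity and characters with `η⁶ = 1` -/

/-- **`σ z = z⁻¹` for every sixth root of unity** `z ∈ ℚ₃(ζ₃)`, for cycu-p1's `σ` (which inverts cube roots
of unity): `z³ = ±1`, and if `z³ = −1` then `(−z)³ = 1`. [folklore] -/
theorem exists_algEquiv_apply_eq_inv_of_pow_six :
    ∃ σ : CyclotomicField 3 ℚ_[3] ≃ₐ[ℚ_[3]] CyclotomicField 3 ℚ_[3],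
      ∀ z : CyclotomicField 3 ℚ_[3], z ^ 6 = 1 → σ z = z⁻¹ := by
  obtain ⟨σ, hσ⟩ := PSCoefficientField.exists_algEquiv_apply_eq_inv_of_pow_three
  refine ⟨σ, fun z hz ↦ ?_⟩
  have h3 : z ^ 3 * z ^ 3 = 1 := by rw [← pow_add]; exact hz
  rcases mul_self_eq_one_iff.mp h3 with h | h
  · exact hσ z h
  · have hneg : (-z) ^ 3 = 1 := by
      rw [neg_pow, h]; norm_num
    have := hσ (-z) hneg
    rw [map_neg, inv_neg, neg_inj] at this
    exact this

/-- **`η.ringHomComp σ = η⁻¹` for every Dirichlet character with `η⁶ = 1`** (any level), valued in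
`ℚ₃(ζ₃)` — orders `3` AND `6` of the route's untwisting character. [cite: Benois2020, §0.3] -/
theorem exists_algEquiv_ringHomComp_eq_inv_of_pow_six :
    ∃ σ : CyclotomicField 3 ℚ_[3] ≃ₐ[ℚ_[3]] CyclotomicField 3 ℚ_[3],
      ∀ (n : ℕ) (η : DirichletCharacter (CyclotomicField 3 ℚ_[3]) n), η ^ 6 = 1 →
        η.ringHomComp (σ : CyclotomicField 3 ℚ_[3] →+* CyclotomicField 3 ℚ_[3]) = η⁻¹ := by
  obtain ⟨σ, hσ⟩ := exists_algEquiv_apply_eq_inv_of_pow_six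
  refine ⟨σ, fun n η hη ↦ ?_⟩
  ext a
  rw [MulChar.ringHomComp_apply, MulChar.inv_apply_eq_inv']
  have ha : (η (a : ZMod n)) ^ 6 = 1 := by
    rw [← MulChar.pow_apply_coe, hη, MulChar.one_apply_coe]
  exact hσ _ ha

/-! ### §2 The conjugate `L`-function exists with the first and shares its invariants (no Carayol) -/

section Curve

variable {W : WeierstrassCurve ℚ}
  (ι : CyclotomicField 3 ℚ_[3] →ₐ[ℚ_[3]] ℂ_[3])
  (ηK : DirichletCharacter (CyclotomicField 3 ℚ_[3]) (3 ^ 2)) (αK : CyclotomicField 3 ℚ_[3])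
  (σ : CyclotomicField 3 ℚ_[3] ≃ₐ[ℚ_[3]] CyclotomicField 3 ℚ_[3])

/-- Rewriting the conjugate character: `η_K.ringHomComp (ι ∘ σ) = ((η_K.ringHomComp σ).ringHomComp ι`, which
is `(η_K.ringHomComp ι)⁻¹` when `η_K.ringHomComp σ = η_K⁻¹`. [folklore] -/
theorem ringHomComp_comp_eq_inv
    (hσ : ηK.ringHomComp (σ : CyclotomicField 3 ℚ_[3] →+* CyclotomicField 3 ℚ_[3]) = ηK⁻¹) :
    ηK.ringHomComp (((ι.comp (σ : CyclotomicField 3 ℚ_[3] →ₐ[ℚ_[3]] CyclotomicField 3 ℚ_[3])) :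
        CyclotomicField 3 ℚ_[3] →ₐ[ℚ_[3]] ℂ_[3]) : CyclotomicField 3 ℚ_[3] →+* ℂ_[3]) =
      (ηK.ringHomComp (ι : CyclotomicField 3 ℚ_[3] →+* ℂ_[3]))⁻¹ := by
  rw [MulChar.ringHomComp_inv, ← hσ]
  ext a
  simp only [MulChar.ringHomComp_apply]
  rfl

/-- **THE CONJUGATE `L`-FUNCTION over `ℚ₃(ζ₃)`.** For `W/ℚ`, an embedding `ι : ℚ₃(ζ₃) →ₐ[ℚ₃] ℂ₃`,
`σ ∈ Aut(ℚ₃(ζ₃)/ℚ₃)` and `η_K` primitive mod `9` with `η_K ∘ σ = η_K⁻¹` (§1: any `η_K` with `η_K⁶ = 1`),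
`α_K ∈ ℚ₃(ζ₃) ∖ {0, 3}`, and `μ` with `IsPSCyclotomicLFunctionOf W (η_K.ringHomComp ι) (ι α_K) μ`: there is a
`ℚ₃(ζ₃)`-valued `μ_K` with `μ = ι ∘ μ_K` (rationality) such that `ι ∘ σ ∘ μ_K` IS an untwisted `L`-function for
the conjugate datum `((η_K ∘ ι)⁻¹, ι (σ α_K))` — `𝓛^{η̄}_W` with the root `ᾱ = σ α` — with the same norms of
ball values and Mahler coefficients, the same order of vanishing and the same leading norm at `𝟙`. No Carayol
hypothesis (the hidden newform of `μ` is reused).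
[cite: MazurTateTeitelbaum1986Invent, §I.10 and §I.14] [cite: BoschGuntzerRemmert1984, §3.2.4 Thm. 2] -/
theorem exists_conjugate_of_isPSCyclotomicLFunctionOf
    (hσ : ηK.ringHomComp (σ : CyclotomicField 3 ℚ_[3] →+* CyclotomicField 3 ℚ_[3]) = ηK⁻¹)
    (hη : ηK.IsPrimitive) (hα : αK ≠ 0) (hα3 : αK ≠ (3 : ℕ)) {μ : (n : ℕ) → ZMod (3 ^ n) → ℂ_[3]}
    (hμ : IsPSCyclotomicLFunctionOf W (ηK.ringHomComp (ι : CyclotomicField 3 ℚ_[3] →+* ℂ_[3])) (ι αK) μ) :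
    ∃ μK : (n : ℕ) → ZMod (3 ^ n) → CyclotomicField 3 ℚ_[3],
      (μ = fun n s ↦ ι (μK n s)) ∧
      IsPSCyclotomicLFunctionOf W (ηK.ringHomComp (ι : CyclotomicField 3 ℚ_[3] →+* ℂ_[3]))⁻¹ (ι (σ αK))
        (fun n s ↦ ι (σ (μK n s))) ∧
      (∀ (n : ℕ) (s : ZMod (3 ^ n)), ‖ι (σ (μK n s))‖ = ‖μ n s‖) ∧
      (∀ k : ℕ, ‖gammaMahlerCoeff 3 (fun n s ↦ ι (σ (μK n s))) k‖ = ‖gammaMahlerCoeff 3 μ k‖) ∧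
      gammaOrderAtOne 3 (fun n s ↦ ι (σ (μK n s))) = gammaOrderAtOne 3 μ ∧
      ‖gammaLeadingCoeff 3 (fun n s ↦ ι (σ (μK n s)))‖ = ‖gammaLeadingCoeff 3 μ‖ := by
  classical
  haveI : Module.Finite ℚ_[3] (CyclotomicField 3 ℚ_[3]) :=
    IsCyclotomicExtension.finite {3} ℚ_[3] (CyclotomicField 3 ℚ_[3])
  haveI : Algebra.IsAlgebraic ℚ_[3] (CyclotomicField 3 ℚ_[3]) :=
    Algebra.IsAlgebraic.of_finite ℚ_[3] (CyclotomicField 3 ℚ_[3])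
  obtain ⟨N, _, f, hf, hL⟩ := hμ
  -- the `ℚ₃(ζ₃)`-valued candidate on the newform `f`
  obtain ⟨SK, νK, ρK, 𝓛K, hSK, hνK, hρK, h𝓛K⟩ := exists_candidateK (p := 3) f ηK αK
  have hι := map_ne_zero_and_ne_natCast (p := 3) (ι : CyclotomicField 3 ℚ_[3] →+* ℂ_[3]) αK hα hα3
  -- `μ` is `ι ∘ 𝓛_K`
  obtain rfl := eq_map_candidate_of_isUntwistedPAdicLFunction (p := 3)
    (ι : CyclotomicField 3 ℚ_[3] →+* ℂ_[3]) f ηK αK SK hSK νK hνK ρK hρK 𝓛K h𝓛K (by norm_num) hη hι.1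
    hι.2 hL
  -- the conjugate candidate has the D1 property for the conjugate datum
  have hconj := isUntwistedPAdicLFunction_conj_candidate (p := 3) ι σ f ηK αK SK hSK νK
    hνK ρK hρK 𝓛K h𝓛K (by norm_num) hη hα hα3 hL
  have hinv := conjugate_invariants_of_isUntwistedPAdicLFunction (p := 3)
    (ι : CyclotomicField 3 ℚ_[3] →+* ℂ_[3])
    (((ι.comp (σ : CyclotomicField 3 ℚ_[3] →ₐ[ℚ_[3]] CyclotomicField 3 ℚ_[3])) :
        CyclotomicField 3 ℚ_[3] →ₐ[ℚ_[3]] ℂ_[3]) : CyclotomicField 3 ℚ_[3] →+* ℂ_[3]) f ηK αK SK hSK νK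
    hνK ρK hρK 𝓛K h𝓛K (fun x ↦ norm_algHom_algEquiv ι σ x) (by norm_num) hη hα hα3 hL hconj
  rw [ringHomComp_comp_eq_inv ι ηK σ hσ] at hconj
  exact ⟨𝓛K, rfl, ⟨N, inferInstance, f, hf, hconj⟩, hinv.2.2.1, hinv.2.2.2.1, hinv.2.2.2.2.1,
    hinv.2.2.2.2.2⟩

/-- **`𝓛^{η̄}_W` exists iff `𝓛^{η}_W` does** (roots `α` and `σ α`; no Carayol hypothesis: the hidden newform
is reused and `exists_isUntwistedPAdicLFunction_map_iff` applied along `ι`, `ι ∘ σ`).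
[cite: MazurTateTeitelbaum1986Invent, §I.14] [cite: BoschGuntzerRemmert1984, §3.2.4 Thm. 2] -/
theorem exists_isPSCyclotomicLFunctionOf_inv_iff
    (hσ : ηK.ringHomComp (σ : CyclotomicField 3 ℚ_[3] →+* CyclotomicField 3 ℚ_[3]) = ηK⁻¹)
    (hη : ηK.IsPrimitive) (hα : αK ≠ 0) (hα3 : αK ≠ (3 : ℕ)) :
    (∃ μ : (n : ℕ) → ZMod (3 ^ n) → ℂ_[3],
        IsPSCyclotomicLFunctionOf W (ηK.ringHomComp (ι : CyclotomicField 3 ℚ_[3] →+* ℂ_[3])) (ι αK) μ) ↔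
      ∃ μ' : (n : ℕ) → ZMod (3 ^ n) → ℂ_[3],
        IsPSCyclotomicLFunctionOf W (ηK.ringHomComp (ι : CyclotomicField 3 ℚ_[3] →+* ℂ_[3]))⁻¹
          (ι (σ αK)) μ' := by
  classical
  haveI : Module.Finite ℚ_[3] (CyclotomicField 3 ℚ_[3]) :=
    IsCyclotomicExtension.finite {3} ℚ_[3] (CyclotomicField 3 ℚ_[3])
  haveI : Algebra.IsAlgebraic ℚ_[3] (CyclotomicField 3 ℚ_[3]) :=
    Algebra.IsAlgebraic.of_finite ℚ_[3] (CyclotomicField 3 ℚ_[3])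
  rw [← ringHomComp_comp_eq_inv ι ηK σ hσ]
  -- at a fixed newform `f` the two existence statements are equivalent (file `…ConjugateLFunctions`)
  set ι₁ : CyclotomicField 3 ℚ_[3] →+* ℂ_[3] :=
    (((ι.comp (σ : CyclotomicField 3 ℚ_[3] →ₐ[ℚ_[3]] CyclotomicField 3 ℚ_[3])) :
      CyclotomicField 3 ℚ_[3] →ₐ[ℚ_[3]] ℂ_[3]) : CyclotomicField 3 ℚ_[3] →+* ℂ_[3]) with hι₁
  have hα₁ : ι (σ αK) = ι₁ αK := rfl
  rw [hα₁]
  -- at a fixed newform `f` the two existence statements are equivalent (file `…ConjugateLFunctions`)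
  have key : ∀ {N : ℕ} [NeZero N] (f : CuspForm (Gamma0 N) 2),
      (∃ μ : (n : ℕ) → ZMod (3 ^ n) → ℂ_[3], IsUntwistedPAdicLFunction 3 f
          (ηK.ringHomComp (ι : CyclotomicField 3 ℚ_[3] →+* ℂ_[3])) (ι αK) μ) ↔
        ∃ μ' : (n : ℕ) → ZMod (3 ^ n) → ℂ_[3], IsUntwistedPAdicLFunction 3 f
          (ηK.ringHomComp ι₁) (ι₁ αK) μ' := by
    intro N _ f
    obtain ⟨SK, νK, ρK, 𝓛K, hSK, hνK, hρK, h𝓛K⟩ := exists_candidateK (p := 3) f ηK αK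
    exact exists_isUntwistedPAdicLFunction_map_iff (p := 3) (ι : CyclotomicField 3 ℚ_[3] →+* ℂ_[3]) ι₁
      f ηK αK SK hSK νK hνK ρK hρK 𝓛K h𝓛K (fun x ↦ norm_algHom_algEquiv ι σ x) (by norm_num) hη hα hα3
  constructor
  · rintro ⟨μ, N, _, f, hf, hL⟩
    obtain ⟨μ', hμ'⟩ := (key f).mp ⟨μ, hL⟩
    exact ⟨μ', N, inferInstance, f, hf, hμ'⟩
  · rintro ⟨μ', N, _, f, hf, hL'⟩
    obtain ⟨μ, hμ⟩ := (key f).mpr ⟨μ', hL'⟩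
    exact ⟨μ, N, inferInstance, f, hf, hμ⟩

/-- **Packaged for the route's `η` of order `3` or `6`**: with `η_K⁶ = 1` the conjugation `σ` of §1 applies, so
the conjugate `L`-function `𝓛^{η̄}_W = ι ∘ σ ∘ μ_K` exists together with `𝓛^{η}_W = ι ∘ μ_K` and shares its
invariants. [cite: MazurTateTeitelbaum1986Invent, §I.10 and §I.14] [cite: Benois2020, §0.3] -/
theorem exists_conjugate_of_isPSCyclotomicLFunctionOf_of_pow_six (hη : ηK.IsPrimitive) (hη6 : ηK ^ 6 = 1)
    (hα : αK ≠ 0) (hα3 : αK ≠ (3 : ℕ)) {μ : (n : ℕ) → ZMod (3 ^ n) → ℂ_[3]}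
    (hμ : IsPSCyclotomicLFunctionOf W (ηK.ringHomComp (ι : CyclotomicField 3 ℚ_[3] →+* ℂ_[3])) (ι αK) μ) :
    ∃ (τ : CyclotomicField 3 ℚ_[3] ≃ₐ[ℚ_[3]] CyclotomicField 3 ℚ_[3])
      (μK : (n : ℕ) → ZMod (3 ^ n) → CyclotomicField 3 ℚ_[3]),
      ηK.ringHomComp (τ : CyclotomicField 3 ℚ_[3] →+* CyclotomicField 3 ℚ_[3]) = ηK⁻¹ ∧
      (μ = fun n s ↦ ι (μK n s)) ∧
      IsPSCyclotomicLFunctionOf W (ηK.ringHomComp (ι : CyclotomicField 3 ℚ_[3] →+* ℂ_[3]))⁻¹ (ι (τ αK))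
        (fun n s ↦ ι (τ (μK n s))) ∧
      (∀ (n : ℕ) (s : ZMod (3 ^ n)), ‖ι (τ (μK n s))‖ = ‖μ n s‖) ∧
      (∀ k : ℕ, ‖gammaMahlerCoeff 3 (fun n s ↦ ι (τ (μK n s))) k‖ = ‖gammaMahlerCoeff 3 μ k‖) ∧
      gammaOrderAtOne 3 (fun n s ↦ ι (τ (μK n s))) = gammaOrderAtOne 3 μ ∧
      ‖gammaLeadingCoeff 3 (fun n s ↦ ι (τ (μK n s)))‖ = ‖gammaLeadingCoeff 3 μ‖ := by
  obtain ⟨τ, hτ⟩ := exists_algEquiv_ringHomComp_eq_inv_of_pow_six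
  obtain ⟨μK, h⟩ := exists_conjugate_of_isPSCyclotomicLFunctionOf ι ηK αK τ (hτ _ ηK hη6) hη hα hα3 hμ
  exact ⟨τ, μK, hτ _ ηK hη6, h⟩

end Curve

/-! ### §3 Granted Carayol's level statement: every `𝓛^{η̄}_W` is `σ ∘ 𝓛^{η}_W` -/

section Carayol

variable {W : WeierstrassCurve ℚ} [W.IsElliptic]
  (ι : CyclotomicField 3 ℚ_[3] →ₐ[ℚ_[3]] ℂ_[3])
  (ηK : DirichletCharacter (CyclotomicField 3 ℚ_[3]) (3 ^ 2)) (αK : CyclotomicField 3 ℚ_[3])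

/-- **`𝓛^{η̄}_W = σ ∘ 𝓛^{η}_W`** (granted Carayol's `IsNewformOf.level_eq_conductorNorm`, hypothesis `hlev`, which
makes D1's curve-level object unique — `PSGammaUniqueness.eq_of_isPSCyclotomicLFunctionOf`): with `ι`, `η_K`
(primitive, `η_K⁶ = 1`), `α_K ∉ {0, 3}` as in §2, if `μ` is `𝓛^{η}_W` (datum `(η_K ∘ ι, ι α_K)`) and `μ'` is
`𝓛^{η̄}_W` (datum `((η_K ∘ ι)⁻¹, ι (σ α_K))` for some `σ` with `η_K ∘ σ = η_K⁻¹`), then `μ = ι ∘ μ_K` and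
`μ' = ι ∘ σ ∘ μ_K` for one `ℚ₃(ζ₃)`-valued `μ_K`.
[cite: MazurTateTeitelbaum1986Invent, §I.10 and §I.14] [cite: Carayol1986] -/
theorem eq_conj_of_isPSCyclotomicLFunctionOf
    (hlev : ∀ (M : ℕ) [NeZero M], IsNewformOf.level_eq_conductorNorm (N := M))
    (σ : CyclotomicField 3 ℚ_[3] ≃ₐ[ℚ_[3]] CyclotomicField 3 ℚ_[3])
    (hσ : ηK.ringHomComp (σ : CyclotomicField 3 ℚ_[3] →+* CyclotomicField 3 ℚ_[3]) = ηK⁻¹)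
    (hη : ηK.IsPrimitive) (hα : αK ≠ 0) (hα3 : αK ≠ (3 : ℕ))
    {μ μ' : (n : ℕ) → ZMod (3 ^ n) → ℂ_[3]}
    (hμ : IsPSCyclotomicLFunctionOf W (ηK.ringHomComp (ι : CyclotomicField 3 ℚ_[3] →+* ℂ_[3])) (ι αK) μ)
    (hμ' : IsPSCyclotomicLFunctionOf W (ηK.ringHomComp (ι : CyclotomicField 3 ℚ_[3] →+* ℂ_[3]))⁻¹
      (ι (σ αK)) μ') :
    ∃ μK : (n : ℕ) → ZMod (3 ^ n) → CyclotomicField 3 ℚ_[3],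
      (μ = fun n s ↦ ι (μK n s)) ∧ (μ' = fun n s ↦ ι (σ (μK n s))) := by
  classical
  haveI : Module.Finite ℚ_[3] (CyclotomicField 3 ℚ_[3]) :=
    IsCyclotomicExtension.finite {3} ℚ_[3] (CyclotomicField 3 ℚ_[3])
  haveI : Algebra.IsAlgebraic ℚ_[3] (CyclotomicField 3 ℚ_[3]) :=
    Algebra.IsAlgebraic.of_finite ℚ_[3] (CyclotomicField 3 ℚ_[3])
  obtain ⟨N, _, f, hf, hL⟩ := hμ
  obtain ⟨SK, νK, ρK, 𝓛K, hSK, hνK, hρK, h𝓛K⟩ := exists_candidateK (p := 3) f ηK αK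
  have hι := map_ne_zero_and_ne_natCast (p := 3) (ι : CyclotomicField 3 ℚ_[3] →+* ℂ_[3]) αK hα hα3
  obtain rfl := eq_map_candidate_of_isUntwistedPAdicLFunction (p := 3)
    (ι : CyclotomicField 3 ℚ_[3] →+* ℂ_[3]) f ηK αK SK hSK νK hνK ρK hρK 𝓛K h𝓛K (by norm_num) hη hι.1
    hι.2 hL
  have hconj := isUntwistedPAdicLFunction_conj_candidate (p := 3) ι σ f ηK αK SK hSK νK
    hνK ρK hρK 𝓛K h𝓛K (by norm_num) hη hα hα3 hL
  rw [ringHomComp_comp_eq_inv ι ηK σ hσ] at hconj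
  have hμ'' : IsPSCyclotomicLFunctionOf W
      (ηK.ringHomComp (ι : CyclotomicField 3 ℚ_[3] →+* ℂ_[3]))⁻¹ (ι (σ αK)) (fun n s ↦ ι (σ (𝓛K n s))) :=
    ⟨N, inferInstance, f, hf, hconj⟩
  exact ⟨𝓛K, rfl, PSGammaUniqueness.eq_of_isPSCyclotomicLFunctionOf hlev hμ' hμ''⟩

/-- **Conjugate `L`-functions share their invariants** (granted `hlev`): for `μ = 𝓛^{η}_W` and `μ' = 𝓛^{η̄}_W`
as in `eq_conj_of_isPSCyclotomicLFunctionOf` — equal norms of ball values and of all Mahler coefficients, the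
same order of vanishing at `𝟙` and the same leading norm. On a rank-one principal-series row this reads
`ord_𝟙 𝓛^{η} = 1 ⟺ ord_𝟙 𝓛^{η̄} = 1` and `‖c₁(𝓛^{η})‖ = ‖c₁(𝓛^{η̄})‖`: any pins `κ_an`, `κ_alg` of K1's
separated closer must be `σ`-equivariant in norm.
[cite: MazurTateTeitelbaum1986Invent, §I.10 and §I.13–§I.14] [cite: Carayol1986] -/
theorem conjugate_invariants_of_isPSCyclotomicLFunctionOf
    (hlev : ∀ (M : ℕ) [NeZero M], IsNewformOf.level_eq_conductorNorm (N := M))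
    (σ : CyclotomicField 3 ℚ_[3] ≃ₐ[ℚ_[3]] CyclotomicField 3 ℚ_[3])
    (hσ : ηK.ringHomComp (σ : CyclotomicField 3 ℚ_[3] →+* CyclotomicField 3 ℚ_[3]) = ηK⁻¹)
    (hη : ηK.IsPrimitive) (hα : αK ≠ 0) (hα3 : αK ≠ (3 : ℕ))
    {μ μ' : (n : ℕ) → ZMod (3 ^ n) → ℂ_[3]}
    (hμ : IsPSCyclotomicLFunctionOf W (ηK.ringHomComp (ι : CyclotomicField 3 ℚ_[3] →+* ℂ_[3])) (ι αK) μ)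
    (hμ' : IsPSCyclotomicLFunctionOf W (ηK.ringHomComp (ι : CyclotomicField 3 ℚ_[3] →+* ℂ_[3]))⁻¹
      (ι (σ αK)) μ') :
    (∀ (n : ℕ) (s : ZMod (3 ^ n)), ‖μ' n s‖ = ‖μ n s‖) ∧
      (∀ k : ℕ, ‖gammaMahlerCoeff 3 μ' k‖ = ‖gammaMahlerCoeff 3 μ k‖) ∧
      gammaOrderAtOne 3 μ' = gammaOrderAtOne 3 μ ∧ ‖gammaLeadingCoeff 3 μ'‖ = ‖gammaLeadingCoeff 3 μ‖ := by
  haveI : Module.Finite ℚ_[3] (CyclotomicField 3 ℚ_[3]) :=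
    IsCyclotomicExtension.finite {3} ℚ_[3] (CyclotomicField 3 ℚ_[3])
  haveI : Algebra.IsAlgebraic ℚ_[3] (CyclotomicField 3 ℚ_[3]) :=
    Algebra.IsAlgebraic.of_finite ℚ_[3] (CyclotomicField 3 ℚ_[3])
  obtain ⟨μK, hμK, hμK'⟩ := eq_conj_of_isPSCyclotomicLFunctionOf ι ηK αK hlev σ hσ hη hα hα3 hμ hμ'
  -- the two systems in the ring-homomorphism currency of `…ConjugateLFunctions`
  set ι₀ : CyclotomicField 3 ℚ_[3] →+* ℂ_[3] := (ι : CyclotomicField 3 ℚ_[3] →+* ℂ_[3]) with hι₀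
  set ι₁ : CyclotomicField 3 ℚ_[3] →+* ℂ_[3] :=
    (((ι.comp (σ : CyclotomicField 3 ℚ_[3] →ₐ[ℚ_[3]] CyclotomicField 3 ℚ_[3])) :
      CyclotomicField 3 ℚ_[3] →ₐ[ℚ_[3]] ℂ_[3]) : CyclotomicField 3 ℚ_[3] →+* ℂ_[3]) with hι₁
  have e₀ : μ = fun n s ↦ ι₀ (μK n s) := hμK
  have e₁ : μ' = fun n s ↦ ι₁ (μK n s) := hμK'
  have hn : ∀ x : CyclotomicField 3 ℚ_[3], ‖ι₁ x‖ = ‖ι₀ x‖ := fun x ↦ norm_algHom_algEquiv ι σ x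
  have hag : IsGammaDistribution 3 (fun n s ↦ ι₀ (μK n s)) ∧
      HasGrowthOrder 3 (1 / 2) (fun n s ↦ ι₀ (μK n s)) := e₀ ▸ hμ.isGammaDistribution_and_hasGrowthOrder
  have h12 : (1 / 2 : ℝ) < 1 := by norm_num
  rw [e₀, e₁]
  exact ⟨fun n s ↦ hn _, norm_gammaMahlerCoeff_map (p := 3) ι₀ ι₁ μK hn hag.1 hag.2 h12,
    gammaOrderAtOne_map (p := 3) ι₀ ι₁ μK hn hag.1 hag.2 h12,
    norm_gammaLeadingCoeff_map (p := 3) ι₀ ι₁ μK hn hag.1 hag.2 h12⟩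

end Carayol

end Summit.BirchSwinnertonDyer.BirchSwinnertonDyer.Theorems.PSConjugateLFunctionsThree

end
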